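import Mathlib
import Literature.Combinatorics.Additive.PollardFourThirds
import Summits.MatrixMultiplication.MatrixMultiplication.Theorems.AbelianSTPPCensusVPFibre

/-!
# Rule U11-G′ of the abelian STPP census: Grynkiewicz's rule U11-G with the Grynkiewicz–Wang 2026 constant `⌊(4t² − 2t)/3⌋`, and its soundness

Cell mm-stpp (rung F-M1), PRE-REG v1 band B3 «past the walls» (seat mm-stpp-theory, gen 13; candidate C₄ᵃ of the planner's line of
record, HOME/STATUS 2026-08-28T19:33:58Z).  The registered rule U11-G (`U11GFormB` / `U11G`, file `AbelianSTPPSieveVP`; soundness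
`STPPRepCount.u11GFormB_of_grynkiewiczWeak` + `grynkiewicz2010_thm_1_1_holds`) reads, for `3 ≤ t ≤ min(P_AB, P_BC)` with `t ≤ L_B(t)`:
`t (P_AB + P_BC) + 1 ≤ UB_B(t) + 2t²` ([Gry10] Thm 1.1 (6)).  Grynkiewicz–Wang 2026 (arXiv:2601.17922, Theorem 1.8 — in the tree as the
KERNEL theorem `Literature.Combinatorics.Additive.GrynkiewiczWang.grynkiewiczWang2026_thm_1_8`, consumer form `…_weak`, seat mm-stpp-lit
gen 19, p661886 / p662303 / p663291 / p663682) improve the main quadratic term from `−2t²` to `−4t²/3`: for `t ≥ 2` and `|A|, |B| ≥ t`,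
either `t|A| + t|B| ≤ Σ_{i≤t} |A +_i B| + ⌊(4t² − 2t)/3⌋` or there are `A′ ⊆ A`, `B′ ⊆ B` with `|A ∖ A′| + |B ∖ B′| ≤ t − 1` and every
element of `A′ + B′` `t`-popular in `A + B`.  For an STPP family the structured branch contradicts the fibre lemma
(`STPPRepCount.lB_le_card_sdiff_add`: `L_B(t) ≤ |X ∖ X′| + |Y ∖ Y′|`) as soon as `t ≤ L_B(t)`, exactly as for U11-G; the ceiling
`N_t(X,Y) ≤ UB_B(t)` is the tree's (B3) `STPPRepCount.Nt_le_ubB`.  Hence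

* `U11GPrimeFormB M a b c` — **rule U11-G′, form B**: for every `t` with `2 ≤ t ≤ min(P_AB, P_BC)` and `t ≤ L_B(t)`:
  `t (P_AB + P_BC) ≤ UB_B(t) + ⌊(4t² − 2t)/3⌋` (ONE clause for all `t ≥ 2`; at `t = 2` the constant is `4`, the old Thm 1.2 clause); the
  same `pAB`, `pBC`, `ubB`, `lB` as the trio's `U11G`;
* `U11GPrime M a b c` — the three letter forms (B; A = letters `(c,a,b)`; C = letters `(b,c,a)`);
* `u11GPrimeFormB_of_isSTPP`, `u11GPrime_of_isSTPP`, `u11GPrimeSound` — **soundness**: the shape data of every `IsSTPP` family with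
  non-empty sets in a finite abelian group `H` is `U11GPrime |H|` (standard axioms; no named fact — GW26 Thm 1.8 is proved in the tree).

The kills of the six wall / witness lists of record (T_D 668, T_C 3 193, T_A 6 834, T_E 477 / 478 / 480) are `AbelianSTPPCensusU11GPrimeWalls.lean`.
Re-threading after the CONSUMER PROBE of seat mm-stpp-lit g19 (`HOME/mm-stpp-lit/calc/gen19/U11GPrimeProbe.scratch.lean`, sha16
21d6d6eda8e44791, rc 0 on the farm), whose statements and proofs this file adopts verbatim with attribution.
WHAT THIS IS NOT: no census number and no `ω` statement; a necessary condition (a strictly stronger clause than `U11G`'s for `t ≥ 3`).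

## References
* D. J. Grynkiewicz, R. Wang, *Pollard's theorem in general abelian groups*, arXiv:2601.17922 (2026), Theorem 1.8 [tree:
  `Literature.Combinatorics.Additive.PollardFourThirds`, cite key GrynkiewiczWang2026].
* D. J. Grynkiewicz, *On extending Pollard's theorem for t-representable sums*, Israel J. Math. 177 (2010) 413–439, Thm 1.1 (rule U11-G).
* H. Cohn, R. Kleinberg, B. Szegedy, C. Umans, FOCS 2005, Def. 5.1 (`IsSTPP`).
-/

set_option linter.dupNamespace false -- `MatrixMultiplication.MatrixMultiplication` (summit = problem, D-0017)
set_option autoImplicit false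

namespace Summit.MatrixMultiplication.MatrixMultiplication.Theorems

open Finset Literature.Computability.AlgebraicComplexity Literature.Combinatorics.Additive
open scoped Pointwise

variable {N : ℕ}

/-- **Rule U11-G′, form B** (U11-G with the Grynkiewicz–Wang 2026 floor): for every `t` with `2 ≤ t ≤ min(P_AB, P_BC)` and `t ≤ L_B(t)`,
`t (P_AB + P_BC) ≤ UB_B(t) + ⌊(4t² − 2t)/3⌋`.  Same bookkeeping functions `pAB`, `pBC`, `ubB`, `lB` as `U11GFormB`.  The shape data of every
`IsSTPP` family with non-empty sets in a finite abelian group of order `M` satisfies it (`u11GPrimeFormB_of_isSTPP`).  No claim by itself. [original] -/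
def U11GPrimeFormB (M : ℕ) (a b c : Fin N → ℕ) : Prop :=
  ∀ t : ℕ, 2 ≤ t → t ≤ pAB a b c → t ≤ pBC a b c → t ≤ lB a b c t →
    t * (pAB a b c + pBC a b c) ≤ ubB M a b c t + (4 * t * t - 2 * t) / 3

/-- **Rule U11-G′, all three letter forms** (B; A = the rule for the rotated family `(C, A, B)`, letters `(c, a, b)`; C = the rotated family
`(B, C, A)`, letters `(b, c, a)`), as for `U11G`.  No claim by itself. [original] -/
def U11GPrime (M : ℕ) (a b c : Fin N → ℕ) : Prop :=
  U11GPrimeFormB M a b c ∧ U11GPrimeFormB M c a b ∧ U11GPrimeFormB M b c a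

/-- **Soundness of rule U11-G′, form B.**  For an STPP family with non-empty sets in a finite abelian group `H`, with `X = ⋃ (B_j − A_j)`,
`Y = ⋃ (C_k − B_k)` (`|X| = P_AB`, `|Y| = P_BC`, `STPPRepCount.card_diffUnion_AB/BC`): Grynkiewicz–Wang 2026 Thm 1.8 (weak dichotomy form,
`GrynkiewiczWang.grynkiewiczWang2026_thm_1_8_weak`; its sum over `X + Y` is at most the tree's `N_t`, a sum over `H`, since `repCount = Pollard.rep`
by `rfl`) gives either the floor `t(P_AB + P_BC) ≤ N_t(X,Y) + ⌊(4t²−2t)/3⌋`, closed by the ceiling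
`N_t ≤ UB_B(t)` (`STPPRepCount.Nt_le_ubB`), or `t`-popular `X′ + Y′` with at most `t − 1` exceptions, contradicting the fibre lemma
`STPPRepCount.lB_le_card_sdiff_add` (`t ≤ L_B(t) ≤ |X∖X′| + |Y∖Y′| ≤ t − 1`).  Proof adopted from the lit-g19 consumer probe; the
source theorem is Grynkiewicz–Wang 2026 Thm 1.8 (tree, kernel). [original] -/
theorem u11GPrimeFormB_of_isSTPP {H : Type} [AddCommGroup H] [Fintype H] [DecidableEq H]
    {A B C : Fin N → Finset H} (h : IsSTPP A B C)
    (hA : ∀ i, (A i).Nonempty) (hB : ∀ i, (B i).Nonempty) (hC : ∀ i, (C i).Nonempty) :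
    U11GPrimeFormB (Fintype.card H) (fun i => (A i).card) (fun i => (B i).card) (fun i => (C i).card) := by
  intro t ht2 htX htY htL
  have hXc : (diffUnion A B).card = pAB (fun i => (A i).card) (fun i => (B i).card) (fun i => (C i).card) :=
    STPPRepCount.card_diffUnion_AB h hC
  have hYc : (diffUnion B C).card = pBC (fun i => (A i).card) (fun i => (B i).card) (fun i => (C i).card) :=
    STPPRepCount.card_diffUnion_BC h hA
  rcases GrynkiewiczWang.grynkiewiczWang2026_thm_1_8_weak H (diffUnion A B) (diffUnion B C) t ht2
      (hXc ▸ htX) (hYc ▸ htY) with hfloor | ⟨X', -, Y', -, hl, hpop⟩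
  · rw [hXc, hYc] at hfloor
    rw [mul_add]
    -- the Literature sum over `X + Y` is at most the tree's `N_t` (a sum over the whole group; `repCount = Pollard.rep` by `rfl`)
    have hsub : (∑ x ∈ diffUnion A B + diffUnion B C, min t (Pollard.rep (diffUnion A B) (diffUnion B C) x)) ≤
        Nt (diffUnion A B) (diffUnion B C) t := by
      unfold Nt
      exact sum_le_sum_of_subset (subset_univ _)
    exact hfloor.trans ((Nat.add_le_add_right hsub _).trans (Nat.add_le_add_right (STPPRepCount.Nt_le_ubB h hB t) _))
  · exfalso
    have hpop' : ∀ x ∈ X', ∀ y ∈ Y', t ≤ repCount (diffUnion A B) (diffUnion B C) (x + y) :=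
      fun x hx y hy => hpop (x + y) (add_mem_add hx hy)
    have hf := STPPRepCount.lB_le_card_sdiff_add h hA hC hpop'
    omega

/-- **Soundness of rule U11-G′, three letter forms**: forms A and C are form B of the rotated families `(C, A, B)`, `(B, C, A)`
(`IsSTPP.rotate`). [original] -/
theorem u11GPrime_of_isSTPP {H : Type} [AddCommGroup H] [Fintype H] [DecidableEq H]
    {A B C : Fin N → Finset H} (h : IsSTPP A B C)
    (hne : ∀ i, (A i).Nonempty ∧ (B i).Nonempty ∧ (C i).Nonempty) :
    U11GPrime (Fintype.card H) (fun i => (A i).card) (fun i => (B i).card) (fun i => (C i).card) :=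
  ⟨u11GPrimeFormB_of_isSTPP h (fun i => (hne i).1) (fun i => (hne i).2.1) (fun i => (hne i).2.2),
    u11GPrimeFormB_of_isSTPP h.rotate.rotate (fun i => (hne i).2.2) (fun i => (hne i).1) (fun i => (hne i).2.1),
    u11GPrimeFormB_of_isSTPP h.rotate (fun i => (hne i).2.1) (fun i => (hne i).2.2) (fun i => (hne i).1)⟩

/-- **`U11GPrimeSound`** — rule U11-G′ in the census's item format (as `u11PSound`, `fp2Sound`): every STPP family with non-empty sets in a
finite abelian group `H` satisfies `U11GPrime |H|` at its shape list.  Standard axioms; no named fact. [original] -/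
theorem u11GPrimeSound : ∀ (H : Type) [AddCommGroup H] [Fintype H] (N : ℕ) (A B C : Fin N → Finset H), IsSTPP A B C →
    (∀ i, (A i).Nonempty ∧ (B i).Nonempty ∧ (C i).Nonempty) →
      U11GPrime (Fintype.card H) (fun i => (A i).card) (fun i => (B i).card) (fun i => (C i).card) := by
  intro H _ _ N A B C h hne
  classical
  exact u11GPrime_of_isSTPP h hne

/-- U11-G′ refines U11-G for `t ≥ 3`: `⌊(4t² − 2t)/3⌋ + 1 ≤ 2t²`, so a U11-G′-admissible list is U11-G-admissible in form B (the `t = 2`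
clauses coincide).  [bookkeeping] -/
theorem u11GFormB_of_u11GPrimeFormB {M : ℕ} {a b c : Fin N → ℕ} (h : U11GPrimeFormB M a b c) : U11GFormB M a b c := by
  intro t ht2 htX htY htL
  have key := h t ht2 htX htY htL
  refine ⟨fun h2 => ?_, fun h3 => ?_⟩
  · subst h2; simpa using key
  · have hq : (4 * t * t - 2 * t) / 3 + 1 ≤ 2 * t ^ 2 := by
      have h1 : (4 * t * t - 2 * t) / 3 ≤ (4 * t * t) / 3 := Nat.div_le_div_right (Nat.sub_le _ _)
      have h2 : (4 * t * t) / 3 < 2 * t ^ 2 := by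
        rw [Nat.div_lt_iff_lt_mul (by norm_num)]; nlinarith
      omega
    omega

/-- U11-G′ refines U11-G (all three letter forms). [bookkeeping] -/
theorem u11G_of_u11GPrime {M : ℕ} {a b c : Fin N → ℕ} (h : U11GPrime M a b c) : U11G M a b c :=
  ⟨u11GFormB_of_u11GPrimeFormB h.1, u11GFormB_of_u11GPrimeFormB h.2.1, u11GFormB_of_u11GPrimeFormB h.2.2⟩

end Summit.MatrixMultiplication.MatrixMultiplication.Theorems
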